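import Summits.HodgeConjecture.CorCM.Census.GroupFreeFaceBasis

/-!
# The group-free face basis, II: the basis faces are independent modulo divisor pairs (unit-triangular for `⊆`);
# unique integer face coordinates of a Hodge vector; the count `2^{n-1} − n`

COR-CM (cell `pub-hodgecm2`), count-neutral kernel census by the binder seat b09 (gen 27; lane GROUP-FREE-FACE-BASIS, André-3's ask A6-R46),
sequel of `Census/GroupFreeFaceBasis.lean` (same group-free model: `A` = any finite place set, labels `Ty A = A → ℤ/2`, `hodge`, `pairs`,
basis faces `bvec A sel Q = faceVec 𝟙_Q i_Q j_Q` indexed by `BIdx A i₀ = {Q : i₀ ∉ Q, |Q| ≥ 2}` for a base place `i₀` and ANY two-place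
selector `sel`).  Theorems only, Mathlib-only mathematics; no `decide` table, no certificate, no named fact, no `sorry`.  HC_CM is not proved
anywhere in this cell; nothing here is a headline and nothing here produces a period.

CONTENT.
* §1 The coordinate functional of `Q`, `λ_Q(v) = v(𝟙_Q) − v(𝟙_Q + 1)` (written out, no new definition): it kills `P`
  (`coord_eq_zero_of_mem_pairs`), and on the basis faces it is UNIT-TRIANGULAR for inclusion (`coord_bvec`):
  `λ_Q(bvec Q') = [Q = Q'] − [Q = Q'∖i] − [Q = Q'∖j] + [Q = Q'∖{i,j}]`, so `λ_Q(bvec Q) = 1` and `λ_Q(bvec Q') = 0` unless `Q ⊆ Q'`.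
* §2 **INDEPENDENCE** (`independent`): if `Σ_Q c_Q · bvec Q ∈ P` then `c = 0` (evaluate `λ_Q` at a `⊆`-maximal `Q` of the support).  Hence the
  classes of the `bvec Q` in `ℤ^{labels}/P` are linearly independent (`linearIndependent_mkQ_bvec`) and span the image of `H`
  (`span_mkQ_bvec_eq`): **the rank-four face classes `F(𝟙_Q; i_Q, j_Q)`, `Q ∈ BIdx`, are a `ℤ`-basis of `H/P`** (`exists_basis`), and
  every Hodge vector has UNIQUE integer face coordinates modulo pairs (`existsUnique_coords`) — André-3's instantaneous HNF certificates
  (`famtest.py::FaceBasis`) in the kernel, for every degree and every selector.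
* §3 THE COUNT: `|BIdx A i₀| = 2^{n−1} − n` (`card_BIdx`), so `H/P` is free of rank `2^{n−1} − n` (`n = |A|`; ranks `1, 4, 11, 26, 57,
  120, 247, 502, 1013` for degrees `2n = 6 … 22`, as in b09 gen 26's numerics and André-3's atlases: `Λ ≅ ℤ^{502}` at degree `20`).

## References
* [Pohlmann1968] H. Pohlmann, Algebraic cycles on abelian varieties of complex multiplication type, Ann. of Math. 88 (1968), Thm 1.
-/

namespace Summit.HodgeConjecture.CorCM.Census.GroupFreeFaceCoordinates

open Finset OddSliceFacesModel OddSliceFacesSquares OddSliceFacesDescent GroupFreeFaceBasis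

variable (A : Type) [Fintype A] [DecidableEq A]

/-! ## §1 The coordinate functionals `λ_Q(v) = v(𝟙_Q) − v(𝟙_Q + 1)` -/

/-- `λ_Q` kills every pair vector. [folklore] -/
theorem coord_pairVec (Q : Finset A) (ψ : Ty A) : pairVec A ψ (ind A Q) - pairVec A ψ (ind A Q + 1) = 0 := by
  have e1 : (ind A Q + 1 = ψ + 1) ↔ (ind A Q = ψ) := add_left_inj 1
  have e2 : (ind A Q + 1 = ψ) ↔ (ind A Q = ψ + 1) := by
    constructor
    · intro h; rw [← h, add_one_add_one]
    · intro h; rw [h, add_one_add_one]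
  simp only [pairVec, Pi.add_apply, Pi.single_apply, e1, e2]
  abel

/-- `λ_Q` kills `P`. [folklore] -/
theorem coord_eq_zero_of_mem_pairs (Q : Finset A) {v : Ty A → ℤ} (hv : v ∈ pairs A) :
    v (ind A Q) - v (ind A Q + 1) = 0 := by
  induction hv using Submodule.span_induction with
  | mem x hx =>
    obtain ⟨ψ, rfl⟩ := hx
    exact coord_pairVec A Q ψ
  | zero => simp
  | add x y _ _ hx hy =>
    simp only [Pi.add_apply]
    linarith
  | smul a x _ hx =>
    simp only [Pi.smul_apply, smul_eq_mul]
    rw [← mul_sub, hx, mul_zero]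

/-- `λ_Q` on an indicator unit vector `e_{𝟙_R}` (both sets avoiding the base place): `[Q = R]`. [folklore] -/
theorem coord_single_ind {i₀ : A} {Q R : Finset A} (hQ : i₀ ∉ Q) (hR : i₀ ∉ R) :
    (Pi.single (ind A R) (1 : ℤ) : Ty A → ℤ) (ind A Q) - (Pi.single (ind A R) (1 : ℤ) : Ty A → ℤ) (ind A Q + 1) =
      if Q = R then 1 else 0 := by
  have e1 : (ind A Q = ind A R) ↔ (Q = R) := (ind_injective A).eq_iff
  simp only [Pi.single_apply, e1, if_neg (ind_add_one_ne_ind A hQ hR), sub_zero]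

/-- **`λ_Q` on the basis faces is unit-triangular for `⊆`**: `λ_Q(bvec Q') = [Q = Q'] − [Q = Q'∖i] − [Q = Q'∖j] + [Q = Q'∖{i,j}]`,
`(i, j) = sel Q'`. [folklore] -/
theorem coord_bvec {i₀ : A} {sel : Finset A → A × A}
    (hsel : ∀ Q : Finset A, 1 < Q.card → (sel Q).1 ∈ Q ∧ (sel Q).2 ∈ Q ∧ (sel Q).1 ≠ (sel Q).2)
    {Q Q' : Finset A} (hQ : i₀ ∉ Q) (hQ' : i₀ ∉ Q') (h1 : 1 < Q'.card) :
    bvec A sel Q' (ind A Q) - bvec A sel Q' (ind A Q + 1) =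
      (if Q = Q' then 1 else 0) - (if Q = Q'.erase (sel Q').1 then 1 else 0) - (if Q = Q'.erase (sel Q').2 then 1 else 0)
        + (if Q = (Q'.erase (sel Q').1).erase (sel Q').2 then 1 else 0) := by
  obtain ⟨hi, hj, hij⟩ := hsel Q' h1
  have hp := coord_eq_zero_of_mem_pairs A Q (faceVec_ind_sub_mem_pairs A hi hj hij)
  have hni : i₀ ∉ Q'.erase (sel Q').1 := fun h => hQ' (Finset.mem_of_mem_erase h)
  have hnj : i₀ ∉ Q'.erase (sel Q').2 := fun h => hQ' (Finset.mem_of_mem_erase h)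
  have hnij : i₀ ∉ (Q'.erase (sel Q').1).erase (sel Q').2 := fun h => hni (Finset.mem_of_mem_erase h)
  simp only [Pi.sub_apply, Pi.add_apply] at hp
  have e0 := coord_single_ind A hQ hQ'
  have e1 := coord_single_ind A hQ hni
  have e2 := coord_single_ind A hQ hnj
  have e3 := coord_single_ind A hQ hnij
  unfold bvec
  linarith

/-- `λ_Q(bvec Q) = 1`. [folklore] -/
theorem coord_bvec_self {i₀ : A} {sel : Finset A → A × A}
    (hsel : ∀ Q : Finset A, 1 < Q.card → (sel Q).1 ∈ Q ∧ (sel Q).2 ∈ Q ∧ (sel Q).1 ≠ (sel Q).2)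
    {Q : Finset A} (hQ : i₀ ∉ Q) (h1 : 1 < Q.card) :
    bvec A sel Q (ind A Q) - bvec A sel Q (ind A Q + 1) = 1 := by
  obtain ⟨hi, hj, _⟩ := hsel Q h1
  rw [coord_bvec A hsel hQ hQ h1, if_pos rfl]
  have h1' : Q ≠ Q.erase (sel Q).1 := fun h => by
    have := Finset.card_erase_lt_of_mem hi; rw [← h] at this; exact lt_irrefl _ this
  have h2' : Q ≠ Q.erase (sel Q).2 := fun h => by
    have := Finset.card_erase_lt_of_mem hj; rw [← h] at this; exact lt_irrefl _ this
  have h3' : Q ≠ (Q.erase (sel Q).1).erase (sel Q).2 := fun h => by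
    have h' := Finset.card_erase_lt_of_mem hi
    have h'' := Finset.card_le_card (Finset.erase_subset (sel Q).2 (Q.erase (sel Q).1))
    rw [← h] at h''
    omega
  rw [if_neg h1', if_neg h2', if_neg h3']
  ring

/-- `λ_Q(bvec Q') = 0` unless `Q ⊆ Q'`. [folklore] -/
theorem coord_bvec_eq_zero {i₀ : A} {sel : Finset A → A × A}
    (hsel : ∀ Q : Finset A, 1 < Q.card → (sel Q).1 ∈ Q ∧ (sel Q).2 ∈ Q ∧ (sel Q).1 ≠ (sel Q).2)
    {Q Q' : Finset A} (hQ : i₀ ∉ Q) (hQ' : i₀ ∉ Q') (h1 : 1 < Q'.card) (hsub : ¬ Q ⊆ Q') :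
    bvec A sel Q' (ind A Q) - bvec A sel Q' (ind A Q + 1) = 0 := by
  rw [coord_bvec A hsel hQ hQ' h1]
  have n1 : Q ≠ Q' := fun h => hsub (h ▸ Finset.Subset.refl _)
  have n2 : Q ≠ Q'.erase (sel Q').1 := fun h => hsub (h ▸ Finset.erase_subset _ _)
  have n3 : Q ≠ Q'.erase (sel Q').2 := fun h => hsub (h ▸ Finset.erase_subset _ _)
  have n4 : Q ≠ (Q'.erase (sel Q').1).erase (sel Q').2 := fun h =>
    hsub (h ▸ (Finset.erase_subset _ _).trans (Finset.erase_subset _ _))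
  rw [if_neg n1, if_neg n2, if_neg n3, if_neg n4]
  ring

/-! ## §2 Independence modulo pairs; the face basis of `H/P` -/

/-- **INDEPENDENCE OF THE BASIS FACES MODULO PAIRS.**  If an integer combination of the `bvec Q`, `Q ∈ BIdx A i₀`, is a combination of
divisor pairs, all its coefficients vanish. [folklore] -/
theorem independent (i₀ : A) {sel : Finset A → A × A}
    (hsel : ∀ Q : Finset A, 1 < Q.card → (sel Q).1 ∈ Q ∧ (sel Q).2 ∈ Q ∧ (sel Q).1 ≠ (sel Q).2)
    (c : BIdx A i₀ → ℤ) (h : ∑ Q, c Q • bvec A sel Q.1 ∈ pairs A) : c = 0 := by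
  by_contra hc
  have hne : (univ.filter fun Q : BIdx A i₀ => c Q ≠ 0).Nonempty := by
    by_contra hempty
    rw [Finset.not_nonempty_iff_eq_empty, Finset.filter_eq_empty_iff] at hempty
    exact hc (funext fun Q => by simpa using hempty (Finset.mem_univ Q))
  obtain ⟨Q, hQmax⟩ := (univ.filter fun Q : BIdx A i₀ => c Q ≠ 0).exists_maximal hne
  have hQ : c Q ≠ 0 := by simpa using hQmax.prop
  have h0 := coord_eq_zero_of_mem_pairs A Q.1 h
  rw [Finset.sum_apply, Finset.sum_apply, ← Finset.sum_sub_distrib] at h0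
  simp only [Pi.smul_apply, smul_eq_mul, ← mul_sub] at h0
  rw [Finset.sum_eq_single_of_mem Q (Finset.mem_univ Q)] at h0
  · rw [coord_bvec_self A hsel Q.2.1 Q.2.2, mul_one] at h0
    exact hQ h0
  · intro Q' _ hne'
    by_cases hc' : c Q' = 0
    · rw [hc', zero_mul]
    · have hQ's : Q' ∈ univ.filter fun Q : BIdx A i₀ => c Q ≠ 0 := by simpa using hc'
      have hnot : ¬ Q.1 ⊆ Q'.1 := fun hsub =>
        hne' (le_antisymm (hQmax.2 hQ's hsub) hsub)
      rw [coord_bvec_eq_zero A hsel Q.2.1 Q'.2.1 Q'.2.2 hnot, mul_zero]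

/-- The classes of the basis faces in `ℤ^{labels} / P` are linearly independent. [folklore] -/
theorem linearIndependent_mkQ_bvec (i₀ : A) {sel : Finset A → A × A}
    (hsel : ∀ Q : Finset A, 1 < Q.card → (sel Q).1 ∈ Q ∧ (sel Q).2 ∈ Q ∧ (sel Q).1 ≠ (sel Q).2) :
    LinearIndependent ℤ (fun Q : BIdx A i₀ => (pairs A).mkQ (bvec A sel Q.1)) := by
  rw [Fintype.linearIndependent_iff]
  intro g hg Q
  have hmem : ∑ i, g i • bvec A sel i.1 ∈ pairs A := by
    rw [← Submodule.Quotient.mk_eq_zero, ← Submodule.mkQ_apply, map_sum]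
    simpa only [map_smul] using hg
  exact congrFun (independent A i₀ hsel g hmem) Q

/-- The classes of the basis faces span the image of `H` in `ℤ^{labels} / P`. [folklore] -/
theorem span_mkQ_bvec_eq (i₀ : A) {sel : Finset A → A × A}
    (hsel : ∀ Q : Finset A, 1 < Q.card → (sel Q).1 ∈ Q ∧ (sel Q).2 ∈ Q ∧ (sel Q).1 ≠ (sel Q).2) :
    Submodule.span ℤ (Set.range fun Q : BIdx A i₀ => (pairs A).mkQ (bvec A sel Q.1)) = (hodge A).map (pairs A).mkQ := by
  rw [hodge_eq_pairs_sup_bSpan A i₀ hsel, Submodule.map_sup, Submodule.mkQ_map_self, bot_sup_eq, bSpan, Submodule.map_span,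
    ← Set.range_comp]
  rfl

/-- **THE FACE BASIS OF `H/P`.**  The classes of the rank-four faces `F(𝟙_Q; i_Q, j_Q)`, `Q ∈ BIdx A i₀`, are a `ℤ`-basis of the image
of the Hodge lattice in `ℤ^{labels} / P` — for every base place and every two-place selector. [folklore] -/
theorem exists_basis (i₀ : A) {sel : Finset A → A × A}
    (hsel : ∀ Q : Finset A, 1 < Q.card → (sel Q).1 ∈ Q ∧ (sel Q).2 ∈ Q ∧ (sel Q).1 ≠ (sel Q).2) :
    ∃ b : Module.Basis (BIdx A i₀) ℤ ((hodge A).map (pairs A).mkQ),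
      ∀ Q, (b Q : (Ty A → ℤ) ⧸ pairs A) = (pairs A).mkQ (bvec A sel Q.1) := by
  have hli := linearIndependent_mkQ_bvec A i₀ hsel
  refine ⟨(Module.Basis.span hli).map (LinearEquiv.ofEq _ _ (span_mkQ_bvec_eq A i₀ hsel)), fun Q => ?_⟩
  rw [Module.Basis.map_apply, LinearEquiv.coe_ofEq_apply, Module.Basis.span_apply]

/-- **UNIQUE INTEGER FACE COORDINATES.**  Every Hodge vector `v` has a unique `c : BIdx → ℤ` with `v − Σ_Q c_Q · bvec Q ∈ P`. [folklore] -/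
theorem existsUnique_coords (i₀ : A) {sel : Finset A → A × A}
    (hsel : ∀ Q : Finset A, 1 < Q.card → (sel Q).1 ∈ Q ∧ (sel Q).2 ∈ Q ∧ (sel Q).1 ≠ (sel Q).2)
    {v : Ty A → ℤ} (hv : v ∈ hodge A) :
    ∃! c : BIdx A i₀ → ℤ, v - ∑ Q, c Q • bvec A sel Q.1 ∈ pairs A := by
  obtain ⟨c, hc⟩ := exists_coords A i₀ hsel hv
  refine ⟨c, hc, fun c' hc' => ?_⟩
  have hd : ∑ Q, (c Q - c' Q) • bvec A sel Q.1 ∈ pairs A := by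
    have hsub := Submodule.sub_mem _ hc' hc
    have e : (v - ∑ Q, c' Q • bvec A sel Q.1) - (v - ∑ Q, c Q • bvec A sel Q.1) = ∑ Q, (c Q - c' Q) • bvec A sel Q.1 := by
      simp only [sub_smul, Finset.sum_sub_distrib]
      abel
    rwa [e] at hsub
  have hz := independent A i₀ hsel (fun Q => c Q - c' Q) hd
  funext Q
  have hQ := congrFun hz Q
  simp only [Pi.zero_apply] at hQ
  omega

/-- The basis span meets `P` trivially: `ℤ⟨bvec⟩ ⊓ P = ⊥`. [folklore] -/
theorem bSpan_inf_pairs_eq_bot (i₀ : A) {sel : Finset A → A × A}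
    (hsel : ∀ Q : Finset A, 1 < Q.card → (sel Q).1 ∈ Q ∧ (sel Q).2 ∈ Q ∧ (sel Q).1 ≠ (sel Q).2) :
    bSpan A i₀ sel ⊓ pairs A = ⊥ := by
  refine eq_bot_iff.mpr fun v hv => ?_
  obtain ⟨hb, hp⟩ := Submodule.mem_inf.mp hv
  obtain ⟨c, hc⟩ := (Submodule.mem_span_range_iff_exists_fun ℤ).mp hb
  have hz := independent A i₀ hsel c (by rw [hc]; exact hp)
  rw [Submodule.mem_bot, ← hc, hz]
  simp

/-! ## §3 The count `|BIdx| = 2^{n−1} − n` -/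

/-- **`|BIdx A i₀| = 2^{n−1} − n`**, `n = |A|`: the subsets of the `n − 1` places `≠ i₀` of cardinality `≥ 2`. [folklore] -/
theorem card_BIdx (i₀ : A) : Fintype.card (BIdx A i₀) = 2 ^ (Fintype.card A - 1) - Fintype.card A := by
  classical
  set S := (univ.erase i₀).powerset with hS
  have hn : 1 ≤ Fintype.card A := Fintype.card_pos_iff.mpr ⟨i₀⟩
  have hScard : S.card = 2 ^ (Fintype.card A - 1) := by
    rw [hS, Finset.card_powerset, Finset.card_erase_of_mem (Finset.mem_univ i₀), Finset.card_univ]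
  -- `BIdx` as a filter of `S`
  have hfilter : Fintype.card (BIdx A i₀) = (S.filter fun Q => 1 < Q.card).card := by
    rw [Fintype.card_subtype]
    congr 1
    ext Q
    simp only [Finset.mem_filter, Finset.mem_univ, true_and, hS, Finset.mem_powerset, Finset.subset_erase, Finset.subset_univ,
      true_and]
  -- the complement: sets of cardinality `0` or `1`
  have hsmall : (S.filter fun Q => ¬ 1 < Q.card).card = Fintype.card A := by
    have hsplit : (S.filter fun Q => ¬ 1 < Q.card) = powersetCard 0 (univ.erase i₀) ∪ powersetCard 1 (univ.erase i₀) := by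
      ext Q
      simp only [Finset.mem_filter, Finset.mem_union, Finset.mem_powersetCard, hS, Finset.mem_powerset]
      constructor
      · rintro ⟨h, hc⟩
        rcases Nat.lt_or_ge Q.card 1 with h0 | h1
        · exact Or.inl ⟨h, by omega⟩
        · exact Or.inr ⟨h, by omega⟩
      · rintro (⟨h, hc⟩ | ⟨h, hc⟩)
        · exact ⟨h, by omega⟩
        · exact ⟨h, by omega⟩
    have hdisj : Disjoint (powersetCard 0 (univ.erase i₀)) (powersetCard 1 (univ.erase i₀)) := by
      rw [Finset.disjoint_left]
      intro Q h0 h1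
      rw [Finset.mem_powersetCard] at h0 h1
      omega
    rw [hsplit, Finset.card_union_of_disjoint hdisj, Finset.card_powersetCard, Finset.card_powersetCard,
      Finset.card_erase_of_mem (Finset.mem_univ i₀), Finset.card_univ, Nat.choose_zero_right, Nat.choose_one_right]
    omega
  have htot := Finset.card_filter_add_card_filter_not (s := S) (fun Q => 1 < Q.card)
  rw [hsmall, hScard] at htot
  rw [hfilter]
  omega

/-- The rank count in closed form for the record: `|BIdx| + n = 2^{n−1}` (no truncated subtraction). [folklore] -/
theorem card_BIdx_add (i₀ : A) : Fintype.card (BIdx A i₀) + Fintype.card A = 2 ^ (Fintype.card A - 1) := by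
  have h := card_BIdx A i₀
  have hn : 1 ≤ Fintype.card A := Fintype.card_pos_iff.mpr ⟨i₀⟩
  -- `n ≤ 2^{n-1}` for `n ≥ 1`
  have hle : Fintype.card A ≤ 2 ^ (Fintype.card A - 1) := by
    obtain ⟨m, hm⟩ : ∃ m, Fintype.card A = m + 1 := ⟨Fintype.card A - 1, by omega⟩
    rw [hm, Nat.add_sub_cancel]
    clear h hm hn
    induction m with
    | zero => simp
    | succ k ih => rw [pow_succ]; omega
  omega

end Summit.HodgeConjecture.CorCM.Census.GroupFreeFaceCoordinates
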